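import Literature.NumberTheory.Sieve.MontgomeryVaughan1975MajorArcs
import HarnessLib

/-!
# Montgomery–Vaughan 1975: choosing the level `P = X^{6a}` by the size of the exceptional conductor
(Page's theorem across three levels), PROVED

Topic `Literature/NumberTheory/Sieve`, namespace `Literature.NumberTheory.Sieve.MontgomeryVaughan1975`
(continuation of `MontgomeryVaughan1975MajorArcs.lean` — the `c₁`-exceptional zero data
`IsExceptionalZero c₁ P r χ β` [MontgomeryVaughanActa1975, §4 Lemma 4.1] — and
`MontgomeryVaughan1975Zeros.lean` — Page's theorem `exists_exceptionalZero_unique`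
[MontgomeryVaughan2007, Cor. 11.10]).

The major-arc formula (6.1͂7) of Montgomery–Vaughan carries the error `X^{1+δ}P⁻¹(n, r̃)` with
`P = X^{6δ}` and `r̃ ≤ P` the exceptional conductor; it is `o(X)` for EVERY `n` as soon as
`r̃ ≤ P^{2/3}` (then `X^{1+δ}P⁻¹ r̃ ≤ X^{1−δ}`).  Page's theorem at `T = X^{6δ}` with a constant
`c > 4c₁` identifies the `c₁`-exceptional characters at the three levels `P_a = X^{6a}`,
`a ∈ {δ/4, 2δ/3, δ}` (all have `r ≤ T` and `β ≥ 1 − c₁/log P_a > 1 − c/log T`), so they share ONE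
conductor `q`; choosing `a = δ/4` if `q ≤ X^{δ}`, `a = δ` if `X^{δ} < q ≤ X^{4δ}`, and `a = 2δ/3`
if `q > X^{4δ}` (then no exceptional character exists at level `X^{4δ} < q`) makes every
exceptional conductor at the chosen level `≤ P_a^{2/3}`.  This is the piece `LevelSelection` of the
parity-ideate route `LinnikGallagherMV` (crux «PointwiseMajorArcsMV»), VERBATIM (`levelSelection`);
the three-level device is the standard use of Page's theorem «at most one exceptional modulus
`q ≤ T`» [MontgomeryVaughan2007, Cor. 11.10] to place the exceptional modulus relative to the
level, as in [MontgomeryVaughanActa1975, §8].  No new facts.  Written for the parity-ideate cell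
(literature seat g16, 2026-08-27).

* `IsExceptionalZero.le_level_and_page` — a `c₁`-exceptional zero at level `X^{6a}`,
  `δ/4 ≤ a ≤ δ`, lies in Page's region at `T = X^{6δ}` when `4c₁ < c`.
* `IsExceptionalZero.quadratic_of_page`, `conductor_eq_of_page` — hence the character is
  quadratic and any two such data (at possibly different levels in `[δ/4, δ]`) have the same
  conductor.
* `levelSelection` — the selection statement.

## References

* [MontgomeryVaughanActa1975] H. L. Montgomery, R. C. Vaughan, *The exceptional set in Goldbach's
  problem*, Acta Arith. 27 (1975) 353–370: §4 Lemma 4.1, §8.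
* [MontgomeryVaughan2007] H. L. Montgomery, R. C. Vaughan, *Multiplicative Number Theory I*,
  CUP 2007, Corollary 11.10 (Page).

## Mathlib / tree search

Tree: `IsExceptionalZero`, `Lemma41At` (`MontgomeryVaughan1975MajorArcs`),
`exists_exceptionalZero_unique` (`MontgomeryVaughan1975Zeros`). `lean search 'levelSelection|le_level_and_page'`:
nothing before this file.
-/

noncomputable section

open Filter

namespace Literature.NumberTheory.Sieve.MontgomeryVaughan1975

/-- **Transfer to Page's region.** If `4c₁ < c`, `0 < δ`, `δ/4 ≤ a ≤ δ` and `X > 1`, a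
`c₁`-exceptional zero datum `(r, χ, β)` at level `P_a = X^{6a}` has `r ≤ T` and
`β > 1 − c/log T` for `T = X^{6δ}` (`c₁/log P_a = c₁/(6a log X) < c/(6δ log X)` because
`c a > 4c₁ a ≥ c₁ δ`). [cite: MontgomeryVaughan2007, Corollary 11.10] -/
theorem IsExceptionalZero.le_level_and_page {c c₁ δ a X : ℝ} {r : ℕ} [NeZero r]
    {χ : DirichletCharacter ℂ r} {β : ℝ} (hc₁ : 0 < c₁) (hc : 4 * c₁ < c) (hδ : 0 < δ)
    (ha : δ / 4 ≤ a) (haδ : a ≤ δ) (hX : 1 < X) (h : IsExceptionalZero c₁ (X ^ (6 * a)) r χ β) :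
    (r : ℝ) ≤ X ^ (6 * δ) ∧ 1 - c / Real.log (X ^ (6 * δ)) < β := by
  obtain ⟨-, -, hrP, hβlo, -, -⟩ := h
  have ha0 : 0 < a := lt_of_lt_of_le (by linarith) ha
  have hlogX : 0 < Real.log X := Real.log_pos hX
  have hX0 : 0 < X := by linarith
  have hPa_le : X ^ (6 * a) ≤ X ^ (6 * δ) :=
    Real.rpow_le_rpow_of_exponent_le hX.le (by linarith)
  refine ⟨hrP.trans hPa_le, lt_of_lt_of_le ?_ hβlo⟩
  rw [Real.log_rpow hX0, Real.log_rpow hX0]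
  have h6a : 0 < 6 * a * Real.log X := by positivity
  have h6δ : 0 < 6 * δ * Real.log X := by positivity
  rw [sub_lt_sub_iff_left, div_lt_div_iff₀ h6a h6δ]
  -- `c₁ * (6 δ log X) < c * (6 a log X)`
  have h1 : c₁ * δ < c * a := by nlinarith
  nlinarith

/-- **Exceptional characters are quadratic** (Page (i) at `T = X^{6δ}`): under the hypotheses of
`IsExceptionalZero.le_level_and_page` and `X^{6δ} ≥ 4`, `χ² = 1`.
[cite: MontgomeryVaughan2007, Corollary 11.10] -/
theorem IsExceptionalZero.quadratic_of_page {c c₁ δ a X : ℝ}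
    (hPage : ∀ (q : ℕ) [NeZero q] (χ : DirichletCharacter ℂ q), χ ≠ 1 → (q : ℝ) ≤ X ^ (6 * δ) →
      ∀ ρ : ℂ, χ.LFunction ρ = 0 → |ρ.im| ≤ X ^ (6 * δ) →
        1 - c / Real.log (X ^ (6 * δ)) < ρ.re → χ ^ 2 = 1 ∧ ρ.im = 0)
    {r : ℕ} [NeZero r] {χ : DirichletCharacter ℂ r} {β : ℝ} (hc₁ : 0 < c₁) (hc : 4 * c₁ < c)
    (hδ : 0 < δ) (ha : δ / 4 ≤ a) (haδ : a ≤ δ) (hX : 1 < X) (hT : 4 ≤ X ^ (6 * δ))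
    (h : IsExceptionalZero c₁ (X ^ (6 * a)) r χ β) : χ ^ 2 = 1 := by
  obtain ⟨hrT, hβ⟩ := h.le_level_and_page hc₁ hc hδ ha haδ hX
  obtain ⟨-, hne, -, -, -, hzero⟩ := h
  exact (hPage r χ hne hrT (β : ℂ) hzero (by simp; linarith) (by simpa using hβ)).1

/-- **One exceptional conductor across the three levels** (Page (ii) at `T = X^{6δ}`): two
`c₁`-exceptional data at levels `X^{6a}`, `X^{6a'}` with `a, a' ∈ [δ/4, δ]` have the same
conductor, provided `4c₁ < c` and `X^{6δ} ≥ 4`. [cite: MontgomeryVaughan2007, Corollary 11.10] -/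
theorem conductor_eq_of_page {c c₁ δ a a' X : ℝ}
    (hPage₁ : ∀ (q : ℕ) [NeZero q] (χ : DirichletCharacter ℂ q), χ ≠ 1 → (q : ℝ) ≤ X ^ (6 * δ) →
      ∀ ρ : ℂ, χ.LFunction ρ = 0 → |ρ.im| ≤ X ^ (6 * δ) →
        1 - c / Real.log (X ^ (6 * δ)) < ρ.re → χ ^ 2 = 1 ∧ ρ.im = 0)
    (hPage₂ : ∀ (q₁ q₂ : ℕ) [NeZero q₁] [NeZero q₂] (χ₁ : DirichletCharacter ℂ q₁)
      (χ₂ : DirichletCharacter ℂ q₂), χ₁ ≠ 1 → χ₂ ≠ 1 → χ₁.IsPrimitive → χ₂.IsPrimitive →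
      χ₁ ^ 2 = 1 → χ₂ ^ 2 = 1 → (q₁ : ℝ) ≤ X ^ (6 * δ) → (q₂ : ℝ) ≤ X ^ (6 * δ) →
      ∀ β₁ β₂ : ℝ, χ₁.LFunction β₁ = 0 → χ₂.LFunction β₂ = 0 →
        1 - c / Real.log (X ^ (6 * δ)) < β₁ → 1 - c / Real.log (X ^ (6 * δ)) < β₂ →
        q₁ = q₂ ∧ β₁ = β₂ ∧ ∀ n : ℕ, χ₁ (n : ZMod q₁) = χ₂ (n : ZMod q₂))
    {r : ℕ} [NeZero r] {χ : DirichletCharacter ℂ r} {β : ℝ}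
    {r' : ℕ} [NeZero r'] {χ' : DirichletCharacter ℂ r'} {β' : ℝ}
    (hc₁ : 0 < c₁) (hc : 4 * c₁ < c) (hδ : 0 < δ) (ha : δ / 4 ≤ a) (haδ : a ≤ δ)
    (ha' : δ / 4 ≤ a') (ha'δ : a' ≤ δ) (hX : 1 < X) (hT : 4 ≤ X ^ (6 * δ))
    (h : IsExceptionalZero c₁ (X ^ (6 * a)) r χ β) (h' : IsExceptionalZero c₁ (X ^ (6 * a')) r' χ' β') :
    r = r' := by
  have hq := h.quadratic_of_page hPage₁ hc₁ hc hδ ha haδ hX hT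
  have hq' := h'.quadratic_of_page hPage₁ hc₁ hc hδ ha' ha'δ hX hT
  obtain ⟨hrT, hβ⟩ := h.le_level_and_page hc₁ hc hδ ha haδ hX
  obtain ⟨hrT', hβ'⟩ := h'.le_level_and_page hc₁ hc hδ ha' ha'δ hX
  obtain ⟨hprim, hne, -, -, -, hzero⟩ := h
  obtain ⟨hprim', hne', -, -, -, hzero'⟩ := h'
  exact (hPage₂ r r' χ χ' hne hne' hprim hprim' hq hq' hrT hrT' β β' hzero hzero' hβ hβ').1

/-- `(X^{6a})^{2/3} = X^{4a}` for `X ≥ 0`. [folklore] -/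
private theorem rpow_six_mul_rpow_two_thirds {X a : ℝ} (hX : 0 ≤ X) :
    (X ^ (6 * a)) ^ (2 / 3 : ℝ) = X ^ (4 * a) := by
  rw [← Real.rpow_mul hX]; ring_nf

/-- **Level selection** — VERBATIM the piece `LevelSelection` of the parity-ideate route
`LinnikGallagherMV` (crux «PointwiseMajorArcsMV»): there is an absolute `c₀ > 0` (a quarter of
Page's constant) such that for `0 < c₁ < c₀`, every `δ > 0` and all large `X` one of the three
levels `a ∈ {δ/4, 2δ/3, δ}` has every `c₁`-exceptional conductor at level `X^{6a}` bounded by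
`(X^{6a})^{2/3}`.  Proof: by Page's theorem at `T = X^{6δ}` all exceptional data at the three levels
share one conductor `q`; take `a = δ/4` if `q ≤ X^{δ}`, `a = δ` if `X^{δ} < q ≤ X^{4δ}`, `a = 2δ/3`
if `q > X^{4δ}` (no datum at that level, since a datum has `r ≤ X^{4δ}`), and any level if there is
no exceptional datum at level `X^{6δ}` (then `a = δ`).
[cite: MontgomeryVaughan2007, Corollary 11.10; MontgomeryVaughanActa1975, §8] -/
theorem levelSelection :
    ∃ c₀ : ℝ, 0 < c₀ ∧ ∀ c₁ : ℝ, 0 < c₁ → c₁ < c₀ → ∀ δ : ℝ, 0 < δ → ∃ X₀ : ℝ, ∀ X : ℝ, X₀ ≤ X →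
      ∃ a : ℝ, (a = δ / 4 ∨ a = 2 * δ / 3 ∨ a = δ) ∧
        ∀ (r : ℕ) [NeZero r] (χ : DirichletCharacter ℂ r) (β : ℝ),
          IsExceptionalZero c₁ (X ^ (6 * a)) r χ β → (r : ℝ) ≤ (X ^ (6 * a)) ^ (2 / 3 : ℝ) := by
  obtain ⟨c, hc, hPage⟩ := exists_exceptionalZero_unique
  refine ⟨c / 4, by positivity, fun c₁ hc₁ hc₁c δ hδ => ?_⟩
  have hc4 : 4 * c₁ < c := by linarith
  -- thresholds: `X > 1` and `T = X^{6δ} ≥ 4`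
  have hev : ∀ᶠ X : ℝ in atTop, 1 < X ∧ 4 ≤ X ^ (6 * δ) := by
    filter_upwards [eventually_gt_atTop (1 : ℝ),
      (tendsto_rpow_atTop (by linarith : 0 < 6 * δ)).eventually_ge_atTop 4] with X h1 h2
    exact ⟨h1, h2⟩
  obtain ⟨X₀, hX₀⟩ := Filter.eventually_atTop.mp hev
  refine ⟨X₀, fun X hX => ?_⟩
  obtain ⟨hX1, hT⟩ := hX₀ X hX
  have hX0 : 0 ≤ X := by linarith
  obtain ⟨hP1, hP2⟩ := hPage (X ^ (6 * δ)) hT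
  -- bounds for the three levels
  have hA : δ / 4 ≤ δ / 4 ∧ δ / 4 ≤ δ := ⟨le_rfl, by linarith⟩
  have hB : δ / 4 ≤ 2 * δ / 3 ∧ 2 * δ / 3 ≤ δ := ⟨by linarith, by linarith⟩
  have hC : δ / 4 ≤ δ ∧ δ ≤ δ := ⟨by linarith, le_rfl⟩
  by_cases hexc : ∃ (q : ℕ) (_ : NeZero q) (χq : DirichletCharacter ℂ q) (βq : ℝ),
      IsExceptionalZero c₁ (X ^ (6 * δ)) q χq βq
  · obtain ⟨q, _, χq, βq, hq⟩ := hexc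
    -- every exceptional datum at a level `a ∈ [δ/4, δ]` has conductor `q`
    have hsame : ∀ a : ℝ, δ / 4 ≤ a → a ≤ δ → ∀ (r : ℕ) [NeZero r] (χ : DirichletCharacter ℂ r)
        (β : ℝ), IsExceptionalZero c₁ (X ^ (6 * a)) r χ β → r = q := by
      intro a ha haδ r _ χ β h
      exact conductor_eq_of_page hP1 hP2 hc₁ hc4 hδ ha haδ hC.1 hC.2 hX1 hT h hq
    by_cases hq1 : (q : ℝ) ≤ X ^ δ
    · -- level `a = δ/4`: `(X^{6a})^{2/3} = X^{δ}`
      refine ⟨δ / 4, Or.inl rfl, fun r _ χ β h => ?_⟩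
      rw [hsame (δ / 4) hA.1 hA.2 r χ β h, rpow_six_mul_rpow_two_thirds hX0]
      convert hq1 using 2; ring
    · by_cases hq2 : (q : ℝ) ≤ X ^ (4 * δ)
      · -- level `a = δ`: `(X^{6δ})^{2/3} = X^{4δ}`
        refine ⟨δ, Or.inr (Or.inr rfl), fun r _ χ β h => ?_⟩
        rw [hsame δ hC.1 hC.2 r χ β h, rpow_six_mul_rpow_two_thirds hX0]
        exact hq2
      · -- level `a = 2δ/3`: no datum (a datum has `r ≤ X^{4δ} < q = r`)
        refine ⟨2 * δ / 3, Or.inr (Or.inl rfl), fun r _ χ β h => ?_⟩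
        exfalso
        have hr := hsame (2 * δ / 3) hB.1 hB.2 r χ β h
        obtain ⟨-, -, hrP, -, -, -⟩ := h
        have : X ^ (6 * (2 * δ / 3)) = X ^ (4 * δ) := by ring_nf
        rw [this, hr] at hrP
        exact hq2 hrP
  · -- no exceptional datum at level `δ`: take `a = δ`
    refine ⟨δ, Or.inr (Or.inr rfl), fun r _ χ β h => ?_⟩
    exact absurd ⟨r, ‹NeZero r›, χ, β, h⟩ hexc

end Literature.NumberTheory.Sieve.MontgomeryVaughan1975

end
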